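import Summits.BirchSwinnertonDyer.BirchSwinnertonDyer.Theorems.PrintCf2RamifiedOffTYZMoverBlockForm
import HarnessLib

/-!
# Crux `PrintCf2.RamifiedOffTYZOfFacts` (stmt-BirchSwinnertonDyer-20509), line `offtyz-v7`, LEAD cycle 8 (cruxlead-20509 g7):
# BLOCK INDEXING — the blocks `d ∣ n`, `d ≡ 5 (mod 8)` of `n = p₁⋯p_k` as the admissible subsets `S ⊆ {1..k}`, and the block form
# of `…MoverBlockForm` read in g5's notation `QForm.blockRho p S` (the right kernel sum of the real Rédei matrix of the block)

THEOREMS ONLY (no `def`, no named fact, no `sorry`), `--supports stmt-BirchSwinnertonDyer-20509`.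
* §1 the sub-tuple `blockPrimes p S` (primes, odd, injective, product `= ∏_{i∈S} pᵢ`); `Σ_{t} kerSum(N_{blockPrimes})_t · f(q_t) =
  Σ_{i ∈ S} blockRho p S i · f(pᵢ)` (`sum_kerSum_blockPrimes_eq_sum_blockRho`).
* §2 subsets ↔ divisors of the square-free `n = ∏ pᵢ` (`sum_powerset_eq_sum_divisors`).
* §3 the Frobenius hypothesis of a block in PRIME form (quantified over primes `q ∣ d`, `r ∣ n`) gives the indexed form for `blockPrimes p S`.
* §4 **`sqMotion_eq_sum_blockRho_mul_bits`**: for an admissible `S` (`d_S = ∏_{i∈S} pᵢ ≡ 5 (mod 8)`) of a displayed `n` and every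
  `g ∈ Gal(ℍ′_n/K_{d_S})`: `[(g*g)^{g(d_S)}σ⁻¹ ∈ Gal(ℍ′_n/H′_{d_S})] = Σ_{i ∈ S} blockRho p S i · [g moves i√−pᵢ]`.
BSD is not proved by any of this; no class is closed by this file.

References: [cite: TianYuanZhang2017, §3.1 (p0011 L1–L13, L53–L64), Prop. 3.2 (1), proof of Lemma 3.21 (p0020 L50–L63)];
[cite: HeathBrown1994SelmerCongruentII, Appendix (Monsky), typescript p. 39 L13–L41]; crux note `Lines/offtyz_v7_QForm.md` §11.
-/

noncomputable section

open scoped Classical NumberField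

open WeierstrassCurve WeierstrassCurve.Affine Finset Matrix Literature.NumberTheory.EllipticCurves
  Literature.NumberTheory.EllipticCurves.TianYuanZhang2017
  Literature.NumberTheory.EllipticCurves.TianYuanZhang2017.W2
  Literature.NumberTheory.EllipticCurves.HeathBrown1994
  Literature.NumberTheory.EllipticCurves.HeathBrown1994.Families
  Literature.NumberTheory.EllipticCurves.Smith2016
  Literature.NumberTheory.QuadraticFields.RingClass
  Literature.NumberTheory.QuadraticFields
  Summit.BirchSwinnertonDyer.Rank1Residual.P2.GenusPeriodTransferLayer
  Summit.BirchSwinnertonDyer.PrintCf2.QForm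

set_option autoImplicit false

namespace Summit.BirchSwinnertonDyer.PrintCf2.MoverAssembly

variable {k : ℕ} (p : Fin k → ℕ) (hp : ∀ i, (p i).Prime) (hodd : ∀ i, Odd (p i)) (hinj : Function.Injective p)

/-! ## §1 The sub-tuple of a block -/

/-- `blockPrimes p S t = p (e t)` for the increasing enumeration `e : Fin #S ≃ S`. [cite: HeathBrown1994SelmerCongruentII, Appendix (Monsky), typescript p. 39 L13–L26] -/
theorem blockPrimes_apply (S : Finset (Fin k)) (t : Fin S.card) :
    blockPrimes p S t = p ((S.orderIsoOfFin rfl).toEquiv t : Fin k) := rfl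

include hp in
/-- The sub-tuple consists of primes. [cite: HeathBrown1994SelmerCongruentII, Appendix (Monsky), typescript p. 39 L13–L26] -/
theorem blockPrimes_prime (S : Finset (Fin k)) : ∀ t, (blockPrimes p S t).Prime := fun _ => hp _

include hodd in
/-- The sub-tuple consists of odd primes. [cite: HeathBrown1994SelmerCongruentII, Appendix (Monsky), typescript p. 39 L13–L26] -/
theorem blockPrimes_odd (S : Finset (Fin k)) : ∀ t, Odd (blockPrimes p S t) := fun _ => hodd _

include hinj in
/-- The sub-tuple is injective. [cite: HeathBrown1994SelmerCongruentII, Appendix (Monsky), typescript p. 39 L13–L26] -/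
theorem blockPrimes_injective (S : Finset (Fin k)) : Function.Injective (blockPrimes p S) :=
  fun _ _ hst => (S.orderIsoOfFin rfl).toEquiv.injective (Subtype.ext (hinj hst))

/-- `∏_t blockPrimes p S t = ∏_{i ∈ S} pᵢ`. [cite: HeathBrown1994SelmerCongruentII, Appendix (Monsky), typescript p. 39 L13–L26] -/
theorem prod_blockPrimes (S : Finset (Fin k)) : ∏ t, blockPrimes p S t = ∏ i ∈ S, p i := by
  simp only [blockPrimes_apply]
  rw [← prod_coe_sort S]
  exact (S.orderIsoOfFin rfl).toEquiv.prod_comp (fun x : {x // x ∈ S} => p (x : Fin k))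

/-- **Re-indexing the block form to g5's `blockRho`**: `Σ_t kerSum(N_{q})_t · f(q_t) = Σ_{i∈S} blockRho p S i · f(pᵢ)` for the sub-tuple
`q = blockPrimes p S` and its real Rédei matrix `N_q = A_q + D₋₁ = QForm.blockRealRedei p S`. [cite: HeathBrown1994SelmerCongruentII, Appendix (Monsky), typescript p. 39 L13–L26] -/
theorem sum_kerSum_blockPrimes_eq_sum_blockRho (S : Finset (Fin k)) (f : ℕ → ZMod 2) :
    (∑ t, kerSum (legendreMatrix (blockPrimes p S) + legendreDiagonal (blockPrimes p S) (-1)) t * f (blockPrimes p S t)) =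
      ∑ i ∈ S, blockRho p S i * f (p i) := by
  set e := (S.orderIsoOfFin rfl).toEquiv with he
  rw [← sum_coe_sort S]
  have hrho : ∀ x : {x // x ∈ S}, blockRho p S (x : Fin k) = kerSum (blockRealRedei p S) (e.symm x) := by
    intro x
    rw [blockRho, dif_pos x.2]
    rfl
  rw [Finset.sum_congr rfl (fun (x : {x // x ∈ S}) _ => by rw [hrho x])]
  rw [← e.sum_comp (fun x : {x // x ∈ S} => kerSum (blockRealRedei p S) (e.symm x) * f (p (x : Fin k)))]
  refine Finset.sum_congr rfl fun t _ => ?_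
  rw [Equiv.symm_apply_apply]
  rfl

/-! ## §2 Subsets of the prime tuple ↔ divisors of `n` -/

include hp hinj in
/-- **`Σ_{S ⊆ {1..k}} f(∏_{i∈S} pᵢ) = Σ_{d ∣ n} f(d)`** for `n = p₁⋯p_k` with distinct primes (the divisors of a square-free number are the
sub-products of its primes, bijectively). [cite: Smith2016CongruentDensity, §2.1 Remark 2.3] -/
theorem sum_powerset_eq_sum_divisors {M : Type*} [AddCommMonoid M] (f : ℕ → M) :
    (∑ S : Finset (Fin k), f (∏ i ∈ S, p i)) = ∑ d ∈ (∏ i, p i).divisors, f d := by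
  have hn0 : (∏ i, p i) ≠ 0 := Finset.prod_ne_zero_iff.mpr fun i _ => (hp i).ne_zero
  refine Finset.sum_nbij' (fun S => ∏ i ∈ S, p i) (fun d => univ.filter (fun i => p i ∣ d)) ?_ ?_ ?_ ?_ ?_
  · intro S _
    exact Nat.mem_divisors.mpr ⟨Finset.prod_dvd_prod_of_subset _ _ _ (subset_univ S), hn0⟩
  · intro d _; exact mem_univ _
  · intro S _
    ext i
    rw [mem_filter, prime_dvd_blockProd_iff p hp hinj]
    simp
  · intro d hd
    exact (eq_blockProd_filter_of_dvd p hp hinj univ (Nat.dvd_of_mem_divisors hd)).symm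
  · intro S _; rfl

include hp in
/-- A sub-product lies in the divisors of `n`. [cite: Smith2016CongruentDensity, §2.1 Remark 2.3] -/
theorem blockProd_mem_divisors (S : Finset (Fin k)) : (∏ i ∈ S, p i) ∈ (∏ i, p i).divisors :=
  Nat.mem_divisors.mpr ⟨Finset.prod_dvd_prod_of_subset _ _ _ (subset_univ S),
    Finset.prod_ne_zero_iff.mpr fun i _ => (hp i).ne_zero⟩

include hp in
/-- `n / ∏_{i∈S} pᵢ = ∏_{i∉S} pᵢ`. [cite: Smith2016CongruentDensity, §2.1 Remark 2.3] -/
theorem prod_div_blockProd (S : Finset (Fin k)) : (∏ i, p i) / (∏ i ∈ S, p i) = ∏ i ∈ Sᶜ, p i := by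
  rw [← Finset.prod_mul_prod_compl S p]
  exact Nat.mul_div_cancel_left _ (blockProd_pos p hp S)

/-! ## §3 The Frobenius hypothesis: prime form ⟹ indexed form -/

variable {n : ℕ} (D : GenusPointData n)

include hp hinj in
/-- The Frobenius hypothesis of a block `d = ∏_{i∈S} pᵢ` quantified over PRIMES (`q ∣ d`, `r ∣ n`, `r ≠ q`) yields the indexed form for
the sub-tuple `blockPrimes p S` used by `sqMotion_eq_kerSum_dotProduct_bits`. [cite: Cox2013, §5.C Lemma 5.19] [cite: TianYuanZhang2017, Prop. 3.2 (1)] -/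
theorem frobenius_indexed_of_prime_form (hn : n = ∏ i, p i) (S : Finset (Fin k)) {ΓH' : Subgroup (D.H ≃ₐ[ℚ] D.H)}
    (hF : ∀ q : ℕ, q.Prime → q ∣ (∏ i ∈ S, p i) → ∃ φ : D.H ≃ₐ[ℚ] D.H,
      φ (D.sqrtNeg (∏ i ∈ S, p i)) = D.sqrtNeg (∏ i ∈ S, p i) ∧ φ * φ ∈ ΓH' ∧
        φ D.im = (jacobiSym (-1) q) • D.im ∧
        ∀ r : ℕ, r.Prime → r ∣ n → r ≠ q → φ (D.sqrtNeg r) = (jacobiSym (-(r : ℤ)) q) • D.sqrtNeg r) :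
    ∀ j : Fin S.card, ∃ φ : D.H ≃ₐ[ℚ] D.H,
      φ (D.sqrtNeg (∏ i ∈ S, p i)) = D.sqrtNeg (∏ i ∈ S, p i) ∧ φ * φ ∈ ΓH' ∧
        φ D.im = (jacobiSym (-1) (blockPrimes p S j)) • D.im ∧
        ∀ i, i ≠ j → φ (D.sqrtNeg (blockPrimes p S i)) =
          (jacobiSym (-(blockPrimes p S i : ℤ)) (blockPrimes p S j)) • D.sqrtNeg (blockPrimes p S i) := by
  intro j
  have hjS : ((S.orderIsoOfFin rfl).toEquiv j : Fin k) ∈ S := ((S.orderIsoOfFin rfl).toEquiv j).2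
  obtain ⟨φ, h1, h2, h3, h4⟩ := hF (blockPrimes p S j) (hp _) (by rw [blockPrimes_apply]; exact dvd_prod_of_mem p hjS)
  refine ⟨φ, h1, h2, h3, fun i hij => h4 _ (hp _) ?_ ?_⟩
  · rw [hn, blockPrimes_apply]; exact dvd_prod_of_mem p (mem_univ _)
  · exact fun h => hij (blockPrimes_injective p hinj S h)

/-! ## §4 The block form in `blockRho` notation -/

include hp hodd hinj in
/-- **THE BLOCK FORM for an admissible subset.**  `n = p₁⋯p_k` square-free, `S ⊆ {1..k}` with `d_S = ∏_{i∈S} pᵢ ≡ 5 (mod 8)` a displayed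
block (`CMBlockSpec`, `RingClassTwoBlockSpec`) satisfying the Frobenius hypothesis in prime form; then for every `g ∈ Gal(ℍ′_n/K_{d_S})`:
`[(g*g)^{g(d_S)}σ⁻¹ ∈ Gal(ℍ′_n/H′_{d_S})] = Σ_{i∈S} blockRho p S i · [g moves i√−pᵢ]`.
[cite: TianYuanZhang2017, §3.1 (p0011 L1–L13, L53–L64), Prop. 3.2 (1), Thm. 3.6 (1), proof of Lemma 3.21 (p0020 L50–L63)]
[cite: Cox2013, §5.C Lemma 5.19, §9.A] [cite: Stevenhagen1995RedeiMatrices, §2 Thm. 1] -/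
theorem sqMotion_eq_sum_blockRho_mul_bits (hn : n = ∏ i, p i) (S : Finset (Fin k)) (hS : (∏ i ∈ S, p i) % 8 = 5)
    {z : APoint D.H} {Φ : Finset (D.H ≃ₐ[ℚ] D.H)} {ΓH ΓH' : Subgroup (D.H ≃ₐ[ℚ] D.H)} {σ c : D.H ≃ₐ[ℚ] D.H}
    (h : D.CMBlockSpec (∏ i ∈ S, p i) z Φ ΓH ΓH' σ c) {ρ : D.galK (∏ i ∈ S, p i) →* RingClassGroup (GenusField (∏ i ∈ S, p i)) 2}
    (hρ : D.RingClassTwoBlockSpec (∏ i ∈ S, p i) ΓH ΓH' ρ)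
    (hF : ∀ q : ℕ, q.Prime → q ∣ (∏ i ∈ S, p i) → ∃ φ : D.H ≃ₐ[ℚ] D.H,
      φ (D.sqrtNeg (∏ i ∈ S, p i)) = D.sqrtNeg (∏ i ∈ S, p i) ∧ φ * φ ∈ ΓH' ∧
        φ D.im = (jacobiSym (-1) q) • D.im ∧
        ∀ r : ℕ, r.Prime → r ∣ n → r ≠ q → φ (D.sqrtNeg r) = (jacobiSym (-(r : ℤ)) q) • D.sqrtNeg r)
    (g : D.H ≃ₐ[ℚ] D.H) (hg : g (D.sqrtNeg (∏ i ∈ S, p i)) = D.sqrtNeg (∏ i ∈ S, p i)) :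
    (if (g * g) ^ gK (∏ i ∈ S, p i) * σ⁻¹ ∈ ΓH' then (1 : ZMod 2) else 0) =
      ∑ i ∈ S, blockRho p S i * (if g (D.im * D.sqrtNeg (p i)) = D.im * D.sqrtNeg (p i) then (0 : ZMod 2) else 1) := by
  have hsq : Squarefree n := by rw [hn]; exact squarefree_prod_of_injective p hp hinj
  have hd : (∏ i ∈ S, p i) ∈ n.divisors := by rw [hn]; exact blockProd_mem_divisors p hp S
  rw [sqMotion_eq_kerSum_dotProduct_bits D (blockPrimes p S) (blockPrimes_prime p hp S) (blockPrimes_odd p hodd S)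
    (blockPrimes_injective p hinj S) hsq hd hS (prod_blockPrimes p S) h hρ (frobenius_indexed_of_prime_form p hp hinj D hn S hF) g hg]
  exact sum_kerSum_blockPrimes_eq_sum_blockRho p S (fun r => if g (D.im * D.sqrtNeg r) = D.im * D.sqrtNeg r then 0 else 1)

end Summit.BirchSwinnertonDyer.PrintCf2.MoverAssembly

end
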